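import Mathlib.Analysis.InnerProductSpace.Laplacian
import Mathlib.Analysis.InnerProductSpace.PiL2
import Mathlib.MeasureTheory.Measure.Hausdorff
import Mathlib.MeasureTheory.Function.LpSeminorm.Basic
import Mathlib.Analysis.Normed.Lp.MeasurableSpace
import Mathlib.Topology.Connected.Basic
import HarnessLib

/-!
# The Banach indicatrix of a smooth function on the round sphere is bounded by `L²` norms of the
# function and of its Laplace–Beltrami image (Polterovich–Sodin 2007, Theorem 1.5)

Analysis/PDE statement file (three NOTIONS, ONE named fact; no `sorry`). Typing job #1 of the
Navier–Stokes cell (DIRECTOR-NS KEY-NS #194, 2026-08-29; the «indicatrix-bound» line of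
`Cruxes/PoloidalLiouville/IndicatrixSketch.lean` v1.2, piece Λ-0b: "a CITED FACT, Polterovich–Sodin
2007 Theorem 1.5 … with `u ≡ 1` on the ROUND UNIT SPHERE … to be typed by a Literature typer as a
named fact"). Nothing here refers to Navier–Stokes.

**Source** (L. Polterovich, M. Sodin, *Nodal inequalities on surfaces*, Math. Proc. Cambridge
Philos. Soc. 143 (2007) = arXiv:math/0604493, §1 p. 3): `M` a compact connected surface with a
Riemannian metric `g`, `‖·‖` the `L²`-norm with respect to the Riemannian area, `Δ` the
Laplace–Beltrami operator, `𝓕` the space of all smooth functions on `M` (vanishing on `∂M` if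
`∂M ≠ ∅`); for a regular value `c` of `f`, `β(c,f)` = the number of connected components of `f⁻¹(c)`,
and for continuous `u` on `ℝ` the generalized Banach indicatrix `B(u,f) = ∫ u(c) β(c,f) dc`.
**Theorem 1.5.** "For any function `f ∈ 𝓕` and any continuous function `u` on `ℝ`,
`B(u,f) ≤ k_g ‖u∘f‖ (‖f‖ + ‖Δf‖)`", `k_g` a positive constant depending only on the metric `g`.

**What is typed** (the special case the consumer uses; `-- TODO(general form)` below): `M = S²`
the round unit sphere of `ℝ³`, `u ≡ 1`, so `‖u∘f‖ = (area S²)^{1/2}` is a constant and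
`B(1,f) = ∫ β(c,f) dc = Λ_{S²}(f)`, the Banach indicatrix (Kronrod's linear variation). MEASURE
CONVENTION: the `L²` norms are taken with respect to `sphereArea := μH[2]⌊S²`, Mathlib's
UNNORMALISED two-dimensional Hausdorff measure (`mkMetric (diam^2)`, no `ω₂/2²` factor), which on
`ℝ³` is the constant multiple `(4/π)·σ` of the Riemannian area `σ` of `S²` (isodiametric
normalisation; total mass `16`, not `4π`; the tree's `4π`-normalised sphere measure is
`volume.toSphere`, cf. `Literature/Analysis/PDE/RellichLemma.lean`). Since BOTH norms scale by the
same factor `(4/π)^{1/2}` and the constant `k` is existential, the typed inequality is EQUIVALENT to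
the printed one for `(S², σ)`; no numerical value of the area is asserted anywhere below.

* `levelComponentCount S f c` — the number (in `ℕ∞`) of connected components of the level set
  `S ∩ f⁻¹(c)` (components relative to the level set, Mathlib's `connectedComponentIn`);
* `banachIndicatrix S f = ∫⁻ c, levelComponentCount S f c` — components counted at EVERY level
  `c`; this agrees with the printed `∫ β(c,f) dc` over regular values because the critical values
  of a smooth `f` on `S²` are Lebesgue-null (Sard) and the lower integral ignores null sets;
* `sphereLaplacian f x = Δ (y ↦ f(y/|y|)) x` — the Laplace–Beltrami operator of the round unit
  sphere applied to `f|_{S²}`, realised through the degree-`0` homogeneous extension (for a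
  `0`-homogeneous `F`, `Δ_{ℝ³} F = r⁻² Δ_{S²} F`, so on `|x| = 1` the Euclidean Laplacian of the
  extension IS `Δ_{S²}(f|_{S²})`; Mathlib has no Laplace–Beltrami operator on manifolds);
* `PolterovichSodin2007_indicatrix_sphere` — THE FACT: `∃ k ≥ 0, ∀ f` smooth on `ℝ³ ∖ {0}`:
  `Λ_{S²}(f) ≤ k (‖f‖_{L²(sphereArea)} + ‖Δ_{S²}f‖_{L²(sphereArea)})`, the norms as
  `eLpNorm · 2 sphereArea` in `ℝ≥0∞` (no real-valued junk; the printed factor `‖1‖ = (area)^{1/2}` and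
  the measure normalisation are absorbed into the existential `k`). The hypothesis "smooth on `ℝ³ ∖ {0}`" covers exactly the smooth
  functions on `S²` (every smooth function on the sphere is the restriction of its `0`-homogeneous
  extension), i.e. the printed class `𝓕` for the closed surface `S²`.

## References

* L. Polterovich, M. Sodin, *Nodal inequalities on surfaces*, Math. Proc. Cambridge Philos. Soc.
  143 (2007) 459–467 = arXiv:math/0604493, §1 Theorem 1.5 (p. 3)
  [corpus: paper:arxiv-math_0604493 p0003 L93–L111]. [PolterovichSodin2007]
* A. S. Kronrod, *On functions of two variables*, Uspekhi Mat. Nauk 5 (1950) (the linear variation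
  / Banach indicatrix); Y. Yomdin, *Global bounds for the Betti numbers of regular fibers of
  differentiable mappings*, Topology 24 (1985).

## Mathlib / tree search

Mathlib: `connectedComponentIn`, `Set.encard`, `MeasureTheory.Measure.hausdorffMeasure` (`μH[2]`),
`MeasureTheory.eLpNorm`, `InnerProductSpace` Laplacian `Δ` (`open scoped Laplacian`). Tree
(`lean search`, 2026-08-29): no Banach indicatrix, no Laplace–Beltrami on spheres, no coarea /
Kronrod–Yomdin bounds; the consumer's Summits sketch defines `levelComponentCount` / `indicatrix` with
the same bodies (it can `simp`-bridge or switch to these).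
-/

noncomputable section

open MeasureTheory Set
open scoped Laplacian ENNReal

namespace Literature.Analysis.PDE

/-! ### The Banach indicatrix -/

/-- **Number of connected components of a level set** (in `ℕ∞`): for `S ⊆ α`, `f : α → ℝ` and a
level `c`, the number of connected components of `S ∩ f⁻¹(c)` — Polterovich–Sodin's `β(c,f)` at
regular values `c` (there finite). [cite: PolterovichSodin2007, §1 p. 3 (definition of β(c,f))] -/
def levelComponentCount {α : Type*} [TopologicalSpace α] (S : Set α) (f : α → ℝ) (c : ℝ) : ℕ∞ :=
  (connectedComponentIn (S ∩ f ⁻¹' {c}) '' (S ∩ f ⁻¹' {c})).encard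

/-- **The Banach indicatrix** (Kronrod's linear variation; Polterovich–Sodin's `B(u,f)` with
`u ≡ 1`): `Λ_S(f) = ∫ β(c,f) dc` as a lower Lebesgue integral in `ℝ≥0∞`, components counted at
every level (the critical values of a smooth function on a surface are Lebesgue-null, so this is
the printed integral over regular values). [cite: PolterovichSodin2007, §1 p. 3 (generalized Banach indicatrix B(u,f), u ≡ 1)] -/
def banachIndicatrix {α : Type*} [TopologicalSpace α] (S : Set α) (f : α → ℝ) : ℝ≥0∞ :=
  ∫⁻ c, ((levelComponentCount S f c : ℕ∞) : ℝ≥0∞)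

/-- Unfolding `banachIndicatrix`. [cite: PolterovichSodin2007, §1 p. 3 (generalized Banach indicatrix B(u,f), u ≡ 1)] -/
theorem banachIndicatrix_eq {α : Type*} [TopologicalSpace α] (S : Set α) (f : α → ℝ) :
    banachIndicatrix S f = ∫⁻ c, ((levelComponentCount S f c : ℕ∞) : ℝ≥0∞) :=
  rfl

/-! ### The round unit sphere of `ℝ³`: area measure and Laplace–Beltrami operator -/

/-- A surface measure on the round unit sphere `S² ⊆ ℝ³`: Mathlib's UNNORMALISED two-dimensional
Hausdorff measure `μH[2]` restricted to `S²`. CONVENTION WARNING: this is NOT literally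
Polterovich–Sodin's Riemannian area `σ` but the constant multiple `(4/π)·σ` (Mathlib's `μH[d]` carries
no `ω_d/2^d` normalisation; total mass `16`, not `4π`); `L²` norms w.r.t. the two measures differ by
the fixed factor `(4/π)^{1/2}`, which the existential constant of the fact absorbs. For the
`4π`-normalised measure use `volume.toSphere`. [cite: PolterovichSodin2007, §1 p. 3 (the Riemannian area σ of M = S², up to the fixed factor 4/π)] -/
def sphereArea : Measure (EuclideanSpace ℝ (Fin 3)) :=
  (Measure.hausdorffMeasure 2).restrict (Metric.sphere (0 : EuclideanSpace ℝ (Fin 3)) 1)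

/-- **The Laplace–Beltrami operator of the round unit sphere** applied to `f|_{S²}`, realised on
`ℝ³ ∖ {0}` through the degree-`0` homogeneous extension `y ↦ f (‖y‖⁻¹ • y)`: for `|x| = 1`,
`sphereLaplacian f x = Δ_{S²}(f|_{S²})(x)` (for a `0`-homogeneous `F`, `Δ_{ℝ³}F = r⁻² Δ_{S²} F`).
Only the values of `f` ON the sphere enter. [cite: PolterovichSodin2007, §1 p. 3 (the Laplace–Beltrami operator Δ; here M = S²)] -/
def sphereLaplacian (f : EuclideanSpace ℝ (Fin 3) → ℝ) (x : EuclideanSpace ℝ (Fin 3)) : ℝ :=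
  (Δ (fun y : EuclideanSpace ℝ (Fin 3) => f (‖y‖⁻¹ • y))) x

/-! ### The fact -/

/-- **Polterovich–Sodin 2007, Theorem 1.5, on the round unit sphere with `u ≡ 1`.** "For any
function `f ∈ 𝓕` and any continuous function `u` on `ℝ`, `B(u,f) ≤ k_g ‖u∘f‖ (‖f‖ + ‖Δf‖)`"
(`M` a compact connected surface with metric `g`, `‖·‖ = L²(σ_g)`, `Δ` = Laplace–Beltrami, `𝓕` = all
smooth functions on `M`); here `M = S² ⊆ ℝ³` round, `u ≡ 1` (`‖u∘f‖ = ‖1‖ = (area)^{1/2}`, a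
constant; `B(1,f) = Λ_{S²}(f)`): there is `k ≥ 0` such that for every `f` smooth on `ℝ³ ∖ {0}`
(⇔ `f|_{S²}` an arbitrary smooth function on the sphere),
`Λ_{S²}(f) ≤ k (‖f‖_{L²(sphereArea)} + ‖Δ_{S²} f‖_{L²(sphereArea)})`, where `sphereArea = μH[2]⌊S²`
is `(4/π)`·(Riemannian area) — the printed constant `k_g (area)^{1/2}` and the factor
`(4/π)^{1/2}` of the measure normalisation are absorbed into `k` (equivalent statement).
-- TODO(general form): every compact connected Riemannian surface `(M,g)` (oriented, `f|∂M = 0` if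
-- `∂M ≠ ∅`) and every continuous weight `u`: `B(u,f) ≤ k_g ‖u∘f‖(‖f‖ + ‖Δf‖)`; spheres `S_r(x₀)` by
-- scaling.
[cite: PolterovichSodin2007, Thm 1.5 (§1 p. 3; arXiv:math/0604493)] -/
def PolterovichSodin2007_indicatrix_sphere : Prop :=
  ∃ k : ℝ, 0 ≤ k ∧ ∀ f : EuclideanSpace ℝ (Fin 3) → ℝ,
    ContDiffOn ℝ (⊤ : ℕ∞) f ({0}ᶜ : Set (EuclideanSpace ℝ (Fin 3))) →
    banachIndicatrix (Metric.sphere (0 : EuclideanSpace ℝ (Fin 3)) 1) f ≤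
      ENNReal.ofReal k * (eLpNorm f 2 sphereArea + eLpNorm (sphereLaplacian f) 2 sphereArea)

end Literature.Analysis.PDE

end
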